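import Summits.AtomisticToContinuum.HydrodynamicLimit.Theses.ImplosionDichotomy
import Summits.AtomisticToContinuum.HydrodynamicLimit.Theorems.TwoClocksEntropyToHydro
import Summits.AtomisticToContinuum.HydrodynamicLimit.Theorems.LambertianContactSwapSwapGapEntropyTools
import Literature.MathematicalPhysics.KineticTheory.HardSphereEulerProofs
import HarnessLib

/-!
# Sketch — crux `HydroLimitProfilewiseBand` (stmt-AtomisticToContinuum-17372), crux-ideate round 1, ideator 1

Idea card `entropy-priced-ring-sparseness` (this folder, `idea-entropy-priced-ring-sparseness.md`).

§1  The PROFILE-WISE entropy dock (service to the crux-plan seat): the guarded Yau target with the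
    packing threshold INSIDE the profile quantifier (`∀ profiles ∃ η`) implies the crux BY NAME —
    `hydroLimitProfilewiseBand_of_relEntropyVanishingProfilewise`, PROVED from the landed
    `Theorems.tendstoHydroFieldsAt_of_klDiv` (p85039).  (It shows the entropy architecture of the
    sibling crux stmt-9133 docks to 17372 with `η` inside; by the ideator's audit no input of that
    architecture gets weaker under `∀∃`, see the card.)
§2  The LEVER, typed: `crowdedCount` / `repeatContactCount` (σ-priced strata), the EQUILIBRIUM
    exponential-moment inputs with tilt up to `log(κ₀/(R³σ³))` (`CrowdingExpMoment`, static, M;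
    `RepeatContactExpMomentLD`, dynamic over a kinetic window, L–XL — the LD form of
    BallisticLaceBootstrap's `EquilibriumRecollisionBound`), the statics `EntropyBudgetLinear`, the
    OUTPUTS `ExpectedCrowdingAlongFlow` / `ExpectedRepeatContactsAlongFlow` (a-priori sparseness IN
    EXPECTATION along the deterministic flow from ANY local Gibbs datum, all times, σ the only small
    parameter), the glue statements — `CrowdingGlue` PROVED (`crowdingGlue_holds`: measurability,
    boundedness, choice of tilt and of `σ₀`, arithmetic), `RepeatContactGlue` typed — and the abstract
    transfer step `integral_comp_flow_le_of_budget` PROVED from the landed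
    `integral_comp_flow_localGibbsLaw_le`.
-/

noncomputable section

open MeasureTheory Filter Set Topology InformationTheory
open scoped ENNReal Classical

namespace Summit.AtomisticToContinuum.HydrodynamicLimit.Cruxes.HydroLimitProfilewiseBand.IdeatorOne

open Literature.MathematicalPhysics.KineticTheory Literature.Analysis.FluidPDE
open Summit.AtomisticToContinuum.HydrodynamicLimit.Theses.ImplosionDichotomy (HydroLimitProfilewiseBand)
open Summit.AtomisticToContinuum.HydrodynamicLimit.Theorems

/-! ## §1 The profile-wise entropy dock -/

/-- **The PROFILE-WISE guarded Yau target**: the sibling line's `RelEntropyVanishingInBand`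
(Cruxes/HydroLimitInBand/Lines/IdeatorOneSketch.lean §1) with `∃ η` moved INSIDE the profile
quantifier, exactly as the crux moves `∃ η₀` inside. -/
def RelEntropyVanishingProfilewise : Prop :=
  ∀ (a₀ θ₀ : T3 → ℝ) (u₀ : T3 → V3), Continuous a₀ → Continuous θ₀ → Continuous u₀ →
    (∀ x, 0 < a₀ x) → (∀ x, 0 < θ₀ x) → ∃ η : ℝ, 0 < η ∧ ∃ σ₀ : ℝ, 0 < σ₀ ∧ ∀ σ : ℝ, 0 < σ → σ < σ₀ →
    ∀ (T : ℝ) (ρ θ : ℝ → T3 → ℝ) (u : ℝ → T3 → V3), IsHardSphereEulerSolution σ T ρ u θ →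
    (∀ t ∈ Set.Ico 0 T, ∀ x, ρ t x * σ ^ 3 < η) →
    ∀ Φ : (N : ℕ) → HardSphereFlow (Torus.geometry (Fin 3)) (hsDiameter σ N) (N + 1),
    (∀ N, IsProbabilityMeasure (localGibbsLaw σ a₀ u₀ θ₀ N (Φ N))) ∧
    (TendstoHydroFieldsAt (fun N => localGibbsLaw σ a₀ u₀ θ₀ N (Φ N)) Φ ρ u θ 0 →
      ∀ t ∈ Set.Ico 0 T, ∃ a : T3 → ℝ,
      (∀ N, IsProbabilityMeasure (localGibbsLaw σ a (u t) (θ t) N (Φ N))) ∧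
      (∀ χ : T3 → ℝ, Continuous χ → ∀ δ : ℝ, 0 < δ → ∃ C : ℝ, 0 < C ∧ ∀ N : ℕ,
        localGibbsLaw σ a (u t) (θ t) N (Φ N)
            {z | δ < |empiricalDensityField z χ - ∫ x, χ x * ρ t x|} ≤
          ENNReal.ofReal (C * Real.exp (-(C⁻¹ * (N + 1)))) ∧
        localGibbsLaw σ a (u t) (θ t) N (Φ N)
            {z | δ < ‖empiricalMomentumField z χ - ∫ x, (χ x * ρ t x) • u t x‖} ≤
          ENNReal.ofReal (C * Real.exp (-(C⁻¹ * (N + 1)))) ∧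
        localGibbsLaw σ a (u t) (θ t) N (Φ N)
            {z | δ < |empiricalEnergyField z χ -
              ∫ x, χ x * totalEnergyDensity (ρ t x) (u t x) (θ t x)|} ≤
          ENNReal.ofReal (C * Real.exp (-(C⁻¹ * (N + 1))))) ∧
      Tendsto (fun N : ℕ => klDiv ((Φ N).lawAt (localGibbsLaw σ a₀ u₀ θ₀ N (Φ N)) t)
        (localGibbsLaw σ a (u t) (θ t) N (Φ N)) / ((N : ℝ≥0∞) + 1)) atTop (𝓝 0))

/-- **Profile-wise dock** `RelEntropyVanishingProfilewise → HydroLimitProfilewiseBand` (the crux BY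
NAME), with the same `η` and the same `σ₀`: at each `t < T` apply the landed entropy-inequality step
`tendstoHydroFieldsAt_of_klDiv`. [cite: Yau1991, §2] -/
theorem hydroLimitProfilewiseBand_of_relEntropyVanishingProfilewise
    (H : RelEntropyVanishingProfilewise) : HydroLimitProfilewiseBand := by
  intro a₀ θ₀ u₀ ha hθ hu ha0 hθ0
  obtain ⟨η, hη, σ₀, hσ₀, G⟩ := H a₀ θ₀ u₀ ha hθ hu ha0 hθ0
  refine ⟨η, hη, σ₀, hσ₀, fun σ hσ hσ' T ρ θ u hE hguard Φ h0 t ht => ?_⟩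
  obtain ⟨_, hmain⟩ := G σ hσ hσ' T ρ θ u hE hguard Φ
  obtain ⟨a, _, hconc, hkl⟩ := hmain h0 t ht
  exact tendstoHydroFieldsAt_of_klDiv (a := a) Φ hconc hkl

/-! ## §2 The lever: σ-priced strata are sparse in expectation along the deterministic flow -/

variable {N : ℕ}

/-- Number of particles having SOME other particle within (torus-Euclidean) distance `r` — the
"crowded" particles (`r = R · ε_N`, a few diameters). [folklore] -/
def crowdedCount (r : ℝ) (z : Config (N + 1) (Fin 3) T3) : ℕ :=
  (Finset.univ.filter fun i : Fin (N + 1) =>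
    ∃ j : Fin (N + 1), j ≠ i ∧ Torus.euclidDist (z i).1 (z j).1 ≤ r).card

/-- Number of particles having a REPEATED pair contact with one and the same partner along the flow
`Φ` within the time window `[s, s + w]` (the per-particle version of the repeated-contact count of
`BallisticLaceBootstrap.EquilibriumRecollisionBound`, via the library's `contactSet`). [folklore] -/
def repeatContactCount {ε : ℝ} (Φ : HardSphereFlow (Torus.geometry (Fin 3)) ε (N + 1)) (s w : ℝ)
    (z : Config (N + 1) (Fin 3) T3) : ℕ :=
  (Finset.univ.filter fun i : Fin (N + 1) => ∃ j : Fin (N + 1), j ≠ i ∧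
    2 ≤ {t : ℝ | t ∈ Set.Icc s (s + w) ∧
      Φ.flow t z ∈ contactSet (Torus.geometry (Fin 3)) (N + 1) ε i j}.ncard).card

/-- **STATIC σ-PRICED INPUT (M; cluster expansion of a dilute "sticky-sphere" tilt).** Under the
homogeneous hard-sphere Gibbs law (activity `1`, zero drift, unit temperature; packing `≍ σ³`) the
number of crowded particles at scale `R ε_N` has exponential moments with tilt `λ` as large as
`½ log(κ₀/(R³σ³))`: `log E_G e^{λ · crowdedCount} ≤ C e^{2λ} R³ σ³ (N+1)` whenever `e^{2λ} R³ σ³ ≤ κ₀`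
(a close pair makes TWO crowded particles, hence `2λ`). The tilted law is a hard-sphere gas with a
square-well attraction; in the polymer representation (polymers = connected components of the
`Rε_N`-proximity graph) a `K`-clump has a-priori weight `≍ (R³σ³)^{K−1}` and reward `≤ e^{Kλ}`, i.e.
activity `≤ (Cκ₀)^{K/2}(R³σ³)^{K/2−1} ≤ (Cκ₀)^{K/2}` for `K ≥ 2`: a convergent polymer expansion
for `κ₀` small, uniformly in `N` (the crude Penrose–Ruelle criterion with the square well's
stability constant is NOT the right test — see the card's cheapest falsifier).
[cite: Ruelle1969, §4.1] -/
def CrowdingExpMoment : Prop :=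
  ∃ κ₀ : ℝ, 0 < κ₀ ∧ ∃ C : ℝ, ∀ R : ℝ, 1 ≤ R → ∃ σ₁ : ℝ, 0 < σ₁ ∧ ∀ σ : ℝ, 0 < σ → σ < σ₁ →
    ∀ Φ : (N : ℕ) → HardSphereFlow (Torus.geometry (Fin 3)) (hsDiameter σ N) (N + 1),
    ∀ lam : ℝ, 0 < lam → Real.exp (2 * lam) * R ^ 3 * σ ^ 3 ≤ κ₀ → ∀ᶠ N : ℕ in atTop,
      Real.log (∫ z, Real.exp (lam * (crowdedCount (R * hsDiameter σ N) z : ℝ))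
          ∂(localGibbsLaw σ (fun _ => 1) (fun _ => 0) (fun _ => 1) N (Φ N))) ≤
        C * Real.exp (2 * lam) * R ^ 3 * σ ^ 3 * ((N : ℝ) + 1)

/-- **DYNAMIC σ-PRICED INPUT (L–XL; the LARGE-DEVIATION form of BallisticLaceBootstrap's bubble
condition `EquilibriumRecollisionBound`, stmt-12105, over ONE short kinetic window).** Under the
invariant homogeneous Gibbs law, the number of particles with a repeated pair contact within a window
of `s ≤ s₀` mean free times (`s₀` a fraction of the mean free time: the Erdős–Rényi-subcritical
regime of dynamical cluster paths, BodineauEtAl2022 Prop. 2.6 / Rem. 2.7), `w = s/((N+1) ε_N²)`,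
has exponential moments with tilt up to
`½ log(κ₀/(s σ³))`: `log E_G e^{λ · repeatContactCount} ≤ C e^{2λ} s σ³ (N+1)` for `e^{2λ} s σ³ ≤ κ₀`
(quick re-encounters are priced by one power of the packing; a dynamical cluster expansion with an
attractive tilt on ring events — the equilibrium technology of Bodineau–Gallagher–Saint-Raymond–
Simonella, here at fixed small packing over a FIXED short window).
[cite: BodineauEtAl2022, Prop. 2.6, Rem. 2.7] -/
def RepeatContactExpMomentLD : Prop :=
  ∃ κ₀ : ℝ, 0 < κ₀ ∧ ∃ s₀ : ℝ, 0 < s₀ ∧ ∃ C : ℝ, ∀ s : ℝ, 0 < s → s ≤ s₀ →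
    ∃ σ₁ : ℝ, 0 < σ₁ ∧ ∀ σ : ℝ, 0 < σ → σ < σ₁ →
    ∀ Φ : (N : ℕ) → HardSphereFlow (Torus.geometry (Fin 3)) (hsDiameter σ N) (N + 1),
    ∀ lam : ℝ, 0 < lam → Real.exp (2 * lam) * s * σ ^ 3 ≤ κ₀ → ∀ᶠ N : ℕ in atTop, ∀ t₀ : ℝ,
      Real.log (∫ z, Real.exp (lam * (repeatContactCount (Φ N) t₀
            (s / (((N : ℝ) + 1) * hsDiameter σ N ^ 2)) z : ℝ))
          ∂(localGibbsLaw σ (fun _ => 1) (fun _ => 0) (fun _ => 1) N (Φ N))) ≤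
        C * Real.exp (2 * lam) * s * σ ^ 3 * ((N : ℝ) + 1)

/-- **STATICS (M, essentially in tree): the conserved entropy budget is LINEAR in `N` with a
profile constant `h`.** `KL(λ_N ‖ G_N) ≤ h (N+1)` for the local Gibbs datum against the homogeneous
Gibbs law, `h = h(a₀, u₀, θ₀)` (specific relative entropy: `∫ρ₀ log ρ₀ + ∫ρ₀[3/2(θ₀ − 1 − log θ₀) +
|u₀|²/2] + O(σ³)`); the tree's `klDiv_lawAt_localGibbsLaw_le_of_bounds` is the finite-`N` form.
[cite: Yau1991, §2] -/
def EntropyBudgetLinear : Prop :=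
  ∀ (a₀ θ₀ : T3 → ℝ) (u₀ : T3 → V3), Continuous a₀ → Continuous θ₀ → Continuous u₀ →
    (∀ x, 0 < a₀ x) → (∀ x, 0 < θ₀ x) → ∃ h : ℝ, 0 < h ∧ ∃ σ₁ : ℝ, 0 < σ₁ ∧ ∀ σ : ℝ, 0 < σ → σ < σ₁ →
    ∀ Φ : (N : ℕ) → HardSphereFlow (Torus.geometry (Fin 3)) (hsDiameter σ N) (N + 1),
    ∀ᶠ N : ℕ in atTop,
      klDiv (localGibbsLaw σ a₀ u₀ θ₀ N (Φ N))
          (localGibbsLaw σ (fun _ => 1) (fun _ => 0) (fun _ => 1) N (Φ N)) ≠ ∞ ∧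
      (klDiv (localGibbsLaw σ a₀ u₀ θ₀ N (Φ N))
          (localGibbsLaw σ (fun _ => 1) (fun _ => 0) (fun _ => 1) N (Φ N))).toReal ≤ h * ((N : ℝ) + 1)

/-- **OUTPUT 1 — crowding is sparse IN EXPECTATION along the deterministic flow, for ALL data, at
ALL times, σ the only small parameter.** For all continuous positive profiles, every tolerance
`κ > 0` and scale `R ≥ 1` there is `σ₀ = σ₀(h(profiles), κ, R)` such that for `0 < σ < σ₀`, all
flows, all large `N` and EVERY `t ∈ ℝ`:
`E_{λ_N}[crowdedCount(R ε_N)(Φ_t z)] ≤ κ (N+1)`. No Euler solution, no packing guard, no horizon.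
[folklore] -/
def ExpectedCrowdingAlongFlow : Prop :=
  ∀ (a₀ θ₀ : T3 → ℝ) (u₀ : T3 → V3), Continuous a₀ → Continuous θ₀ → Continuous u₀ →
    (∀ x, 0 < a₀ x) → (∀ x, 0 < θ₀ x) → ∀ κ : ℝ, 0 < κ → ∀ R : ℝ, 1 ≤ R →
    ∃ σ₀ : ℝ, 0 < σ₀ ∧ ∀ σ : ℝ, 0 < σ → σ < σ₀ →
    ∀ Φ : (N : ℕ) → HardSphereFlow (Torus.geometry (Fin 3)) (hsDiameter σ N) (N + 1),
    ∀ᶠ N : ℕ in atTop, ∀ t : ℝ,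
      ∫ z, (crowdedCount (R * hsDiameter σ N) ((Φ N).flow t z) : ℝ)
          ∂(localGibbsLaw σ a₀ u₀ θ₀ N (Φ N)) ≤ κ * ((N : ℝ) + 1)

/-- **OUTPUT 2 — the a-priori RING-DENSITY input "along f_t" (BallisticLaceBootstrap item 17624's
why-might-fail: "an a-priori ring-density input nobody has") IN EXPECTATION, for all data, all
window positions `t₀`, σ the only small parameter.** [folklore] -/
def ExpectedRepeatContactsAlongFlow : Prop :=
  ∀ (a₀ θ₀ : T3 → ℝ) (u₀ : T3 → V3), Continuous a₀ → Continuous θ₀ → Continuous u₀ →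
    (∀ x, 0 < a₀ x) → (∀ x, 0 < θ₀ x) → ∃ s₀ : ℝ, 0 < s₀ ∧ ∀ κ : ℝ, 0 < κ → ∀ s : ℝ, 0 < s → s ≤ s₀ →
    ∃ σ₀ : ℝ, 0 < σ₀ ∧ ∀ σ : ℝ, 0 < σ → σ < σ₀ →
    ∀ Φ : (N : ℕ) → HardSphereFlow (Torus.geometry (Fin 3)) (hsDiameter σ N) (N + 1),
    ∀ᶠ N : ℕ in atTop, ∀ t₀ : ℝ,
      ∫ z, (repeatContactCount (Φ N) t₀ (s / (((N : ℝ) + 1) * hsDiameter σ N ^ 2))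
            ((Φ N).flow 0 z) : ℝ) ∂(localGibbsLaw σ a₀ u₀ θ₀ N (Φ N)) ≤ κ * ((N : ℝ) + 1)

/-- GLUE 1 (M: measurability of `crowdedCount`, the bound `0 ≤ crowdedCount ≤ N+1`, the abstract
transfer `integral_comp_flow_le_of_budget` below with `λ := log(κ₀/(R³σ³))`, and the arithmetic
`(h + Cκ₀)/λ ≤ κ` for `σ` small). -/
def CrowdingGlue : Prop :=
  EntropyBudgetLinear → CrowdingExpMoment → ExpectedCrowdingAlongFlow

/-- GLUE 2 (M: same transfer, applied to the WINDOW functional `repeatContactCount ∘ (shift by t₀)`;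
invariance of `G_N` makes the equilibrium moment independent of `t₀`). -/
def RepeatContactGlue : Prop :=
  EntropyBudgetLinear → RepeatContactExpMomentLD → ExpectedRepeatContactsAlongFlow

/-- **The abstract transfer step, PROVED** (corollary of the landed
`integral_comp_flow_localGibbsLaw_le`, Kipnis–Landim App. 1 §8 + entropy conservation): a KL
budget `≤ H` against the invariant homogeneous Gibbs law and an equilibrium log-exponential moment
`≤ M` at tilt `λ` bound the expectation of `Y ∘ Φ_t` under the evolved local Gibbs law by
`(H + M)/λ` — at EVERY time `t`. [cite: KipnisLandim1999, Appendix 1 §8] -/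
theorem integral_comp_flow_le_of_budget {σ : ℝ} (hσ : σ ≤ 1 / 2) {a₀ θ₀ : T3 → ℝ}
    {u₀ : T3 → V3} (ha : Continuous a₀) (hθ : Continuous θ₀) (hu : Continuous u₀)
    (ha0 : ∀ x, 0 < a₀ x) (hθ0 : ∀ x, 0 < θ₀ x) {a θ : ℝ} (ha' : 0 < a) (hθ' : 0 < θ) (u : V3)
    (N : ℕ) (Φ : HardSphereFlow (Torus.geometry (Fin 3)) (hsDiameter σ N) (N + 1)) (t : ℝ)
    {H M : ℝ}
    (hfin : klDiv (localGibbsLaw σ a₀ u₀ θ₀ N Φ)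
      (localGibbsLaw σ (fun _ => a) (fun _ => u) (fun _ => θ) N Φ) ≠ ∞)
    (hH : (klDiv (localGibbsLaw σ a₀ u₀ θ₀ N Φ)
      (localGibbsLaw σ (fun _ => a) (fun _ => u) (fun _ => θ) N Φ)).toReal ≤ H)
    {Y : Config (N + 1) (Fin 3) T3 → ℝ} (hY : Measurable Y) {B : ℝ} (hYb : ∀ z, |Y z| ≤ B)
    {lam : ℝ} (hlam : 0 < lam)
    (hM : Real.log (∫ z, Real.exp (lam * Y z)
      ∂(localGibbsLaw σ (fun _ => a) (fun _ => u) (fun _ => θ) N Φ)) ≤ M) :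
    ∫ z, Y (Φ.flow t z) ∂(localGibbsLaw σ a₀ u₀ θ₀ N Φ) ≤ (H + M) / lam := by
  have h := integral_comp_flow_localGibbsLaw_le hσ ha hθ hu ha0 hθ0 ha' hθ' u N Φ t hfin hY hYb hlam
  calc ∫ z, Y (Φ.flow t z) ∂(localGibbsLaw σ a₀ u₀ θ₀ N Φ)
      ≤ lam⁻¹ * ((klDiv (localGibbsLaw σ a₀ u₀ θ₀ N Φ)
          (localGibbsLaw σ (fun _ => a) (fun _ => u) (fun _ => θ) N Φ)).toReal +
          Real.log (∫ z, Real.exp (lam * Y z)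
            ∂(localGibbsLaw σ (fun _ => a) (fun _ => u) (fun _ => θ) N Φ))) := h
    _ ≤ lam⁻¹ * (H + M) := by
        exact mul_le_mul_of_nonneg_left (add_le_add hH hM) (inv_nonneg.2 hlam.le)
    _ = (H + M) / lam := by rw [inv_mul_eq_div]

/-! ### The crowding glue, PROVED (measurability + arithmetic) -/

/-- The crowded set of one particle is measurable (finite union of measurable conditions; joint
continuity of the minimal-image distance, `Torus.continuous_euclidDist`, composed with the measurable
position pairing — the tree's pattern of `measurableSet_pairNear`). [folklore] -/
theorem measurableSet_crowded (r : ℝ) (i : Fin (N + 1)) :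
    MeasurableSet {z : Config (N + 1) (Fin 3) T3 |
      ∃ j : Fin (N + 1), j ≠ i ∧ Torus.euclidDist (z i).1 (z j).1 ≤ r} := by
  rw [Set.setOf_exists]
  refine MeasurableSet.iUnion fun j => ?_
  rw [Set.setOf_and]
  refine (MeasurableSet.const _).inter ?_
  have h1 : Measurable fun z : Config (N + 1) (Fin 3) T3 => ((z i).1, (z j).1) :=
    (measurable_fst.comp (measurable_pi_apply i)).prodMk (measurable_fst.comp (measurable_pi_apply j))
  have h2 : Measurable fun z : Config (N + 1) (Fin 3) T3 => Torus.euclidDist (z i).1 (z j).1 := by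
    simpa only [Function.comp_def] using (Torus.continuous_euclidDist (d := Fin 3)).measurable.comp h1
  exact measurableSet_le h2 measurable_const

/-- `crowdedCount` as a sum of indicators (cast to `ℝ`). [folklore] -/
theorem crowdedCount_cast_eq_sum (r : ℝ) (z : Config (N + 1) (Fin 3) T3) :
    (crowdedCount r z : ℝ) = ∑ i : Fin (N + 1),
      (if ∃ j : Fin (N + 1), j ≠ i ∧ Torus.euclidDist (z i).1 (z j).1 ≤ r then (1 : ℝ) else 0) := by
  unfold crowdedCount
  rw [Finset.card_filter]
  push_cast
  rfl

/-- `crowdedCount` is measurable. [folklore] -/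
theorem measurable_crowdedCount_cast (r : ℝ) :
    Measurable fun z : Config (N + 1) (Fin 3) T3 => (crowdedCount r z : ℝ) := by
  have h : (fun z : Config (N + 1) (Fin 3) T3 => (crowdedCount r z : ℝ)) = fun z => ∑ i : Fin (N + 1),
      (if ∃ j : Fin (N + 1), j ≠ i ∧ Torus.euclidDist (z i).1 (z j).1 ≤ r then (1 : ℝ) else 0) := by
    funext z; exact crowdedCount_cast_eq_sum r z
  rw [h]
  refine Finset.measurable_sum _ fun i _ => ?_
  exact Measurable.ite (measurableSet_crowded r i) measurable_const measurable_const

/-- `0 ≤ crowdedCount ≤ N + 1`. [folklore] -/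
theorem abs_crowdedCount_cast_le (r : ℝ) (z : Config (N + 1) (Fin 3) T3) :
    |(crowdedCount r z : ℝ)| ≤ (N : ℝ) + 1 := by
  rw [abs_of_nonneg (Nat.cast_nonneg _)]
  have h : crowdedCount r z ≤ N + 1 := by
    unfold crowdedCount
    calc (Finset.univ.filter fun i : Fin (N + 1) =>
            ∃ j : Fin (N + 1), j ≠ i ∧ Torus.euclidDist (z i).1 (z j).1 ≤ r).card
        ≤ (Finset.univ : Finset (Fin (N + 1))).card := Finset.card_filter_le _ _
      _ = N + 1 := by simp
  exact_mod_cast h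

/-- **GLUE 1, PROVED.** From the linear entropy budget and the static σ-priced exponential moment, the
expected crowded fraction along the deterministic flow is `≤ κ` for `σ < σ₀(h, κ, R)`, at every time:
tilt `λ := (h + |C|κ₀ + 1)/κ`, then `σ₀ := min(σ₁, σ₁', 1/2, κ₀ e^{−2λ}/R³)` (using `σ³ ≤ σ` for
`σ ≤ 1`), and `integral_comp_flow_le_of_budget`. [cite: KipnisLandim1999, Appendix 1 §8] -/
theorem crowdingGlue_holds : CrowdingGlue := by
  unfold CrowdingGlue ExpectedCrowdingAlongFlow EntropyBudgetLinear CrowdingExpMoment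
  intro hB hM a₀ θ₀ u₀ ha hθ hu ha0 hθ0 κ hκ R hR
  obtain ⟨κ₀, hκ₀, C, hM⟩ := hM
  obtain ⟨σ₁', hσ₁', hM⟩ := hM R hR
  obtain ⟨h, hh, σ₁, hσ₁, hB⟩ := hB a₀ θ₀ u₀ ha hθ hu ha0 hθ0
  have hR0 : 0 < R := lt_of_lt_of_le one_pos hR
  have hR3 : 0 < R ^ 3 := by positivity
  set lam : ℝ := (h + |C| * κ₀ + 1) / κ with hlam_def
  have hnum : 0 < h + |C| * κ₀ + 1 := by positivity
  have hlam : 0 < lam := div_pos hnum hκ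
  set bnd : ℝ := κ₀ * Real.exp (-(2 * lam)) / R ^ 3 with hbnd_def
  have hbnd : 0 < bnd := by positivity
  refine ⟨min (min σ₁ σ₁') (min (1 / 2) bnd), by positivity, ?_⟩
  intro σ hσ hσlt Φ
  have hσ₁lt : σ < σ₁ := lt_of_lt_of_le hσlt ((min_le_left _ _).trans (min_le_left _ _))
  have hσ₁'lt : σ < σ₁' := lt_of_lt_of_le hσlt ((min_le_left _ _).trans (min_le_right _ _))
  have hσhalf : σ ≤ 1 / 2 := (le_of_lt hσlt).trans ((min_le_right _ _).trans (min_le_left _ _))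
  have hσbnd : σ < bnd := lt_of_lt_of_le hσlt ((min_le_right _ _).trans (min_le_right _ _))
  -- the tilt condition `e^{2λ} R³ σ³ ≤ κ₀`
  have hσ1 : σ ≤ 1 := hσhalf.trans (by norm_num)
  have hσ3 : σ ^ 3 ≤ σ := by
    calc σ ^ 3 = σ * (σ * σ) := by ring
      _ ≤ σ * (1 * 1) := by
          exact mul_le_mul_of_nonneg_left (mul_le_mul hσ1 hσ1 hσ.le zero_le_one) hσ.le
      _ = σ := by ring
  have htilt : Real.exp (2 * lam) * R ^ 3 * σ ^ 3 ≤ κ₀ := by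
    have h1 : σ ^ 3 ≤ bnd := hσ3.trans hσbnd.le
    have h2 : Real.exp (2 * lam) * R ^ 3 * σ ^ 3 ≤ Real.exp (2 * lam) * R ^ 3 * bnd :=
      mul_le_mul_of_nonneg_left h1 (by positivity)
    have h3 : Real.exp (2 * lam) * R ^ 3 * bnd = κ₀ := by
      rw [hbnd_def]
      field_simp
      rw [← Real.exp_add]
      simp
    linarith
  have hMσ := hM σ hσ hσ₁'lt Φ lam hlam htilt
  have hBσ := hB σ hσ hσ₁lt Φ
  filter_upwards [hMσ, hBσ] with N hMN hBN
  intro t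
  obtain ⟨hfin, hH⟩ := hBN
  -- the exponential-moment bound in the form `≤ |C| κ₀ (N+1)`
  have hMN' : Real.log (∫ z, Real.exp (lam * (crowdedCount (R * hsDiameter σ N) z : ℝ))
      ∂(localGibbsLaw σ (fun _ => 1) (fun _ => 0) (fun _ => 1) N (Φ N))) ≤ |C| * κ₀ * ((N : ℝ) + 1) := by
    have hN1 : (0 : ℝ) ≤ (N : ℝ) + 1 := by positivity
    have hx : 0 ≤ Real.exp (2 * lam) * R ^ 3 * σ ^ 3 := by positivity
    calc Real.log (∫ z, Real.exp (lam * (crowdedCount (R * hsDiameter σ N) z : ℝ))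
            ∂(localGibbsLaw σ (fun _ => 1) (fun _ => 0) (fun _ => 1) N (Φ N)))
        ≤ C * Real.exp (2 * lam) * R ^ 3 * σ ^ 3 * ((N : ℝ) + 1) := hMN
      _ = C * (Real.exp (2 * lam) * R ^ 3 * σ ^ 3) * ((N : ℝ) + 1) := by ring
      _ ≤ |C| * (Real.exp (2 * lam) * R ^ 3 * σ ^ 3) * ((N : ℝ) + 1) := by
          exact mul_le_mul_of_nonneg_right (mul_le_mul_of_nonneg_right (le_abs_self C) hx) hN1
      _ ≤ |C| * κ₀ * ((N : ℝ) + 1) := by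
          exact mul_le_mul_of_nonneg_right (mul_le_mul_of_nonneg_left htilt (abs_nonneg C)) hN1
  have key := integral_comp_flow_le_of_budget (a₀ := a₀) (θ₀ := θ₀) (u₀ := u₀) hσhalf ha hθ hu ha0 hθ0
    (a := 1) (θ := 1) one_pos one_pos (0 : V3) N (Φ N) t hfin hH
    (measurable_crowdedCount_cast (R * hsDiameter σ N)) (abs_crowdedCount_cast_le (R * hsDiameter σ N))
    hlam hMN'
  -- arithmetic: `(h(N+1) + |C|κ₀(N+1))/λ ≤ κ (N+1)`
  have hfinal : (h * ((N : ℝ) + 1) + |C| * κ₀ * ((N : ℝ) + 1)) / lam ≤ κ * ((N : ℝ) + 1) := by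
    rw [div_le_iff₀ hlam, hlam_def]
    have hN1 : (0 : ℝ) ≤ (N : ℝ) + 1 := by positivity
    have : h * ((N : ℝ) + 1) + |C| * κ₀ * ((N : ℝ) + 1) ≤ (h + |C| * κ₀ + 1) * ((N : ℝ) + 1) := by
      nlinarith
    calc h * ((N : ℝ) + 1) + |C| * κ₀ * ((N : ℝ) + 1)
        ≤ (h + |C| * κ₀ + 1) * ((N : ℝ) + 1) := this
      _ = κ * ((N : ℝ) + 1) * ((h + |C| * κ₀ + 1) / κ) := by
          field_simp
  exact key.trans hfinal

/-- **TIGHTNESS of the lever (what NO budget argument can buy)**: conditioning the reference law on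
an event `A` costs exactly `−log G(A)` of relative entropy, so an event of SUB-EXTENSIVE price
(`−log G_N(A_N) = o(N)`: energy tails, activity tails, Newton-cradle relays, o(N)-sized
collision-connected monsters) is compatible with every linear budget `h N` — the lever controls
precisely the EXTENSIVELY priced strata (and, with tilt `→ ∞` in an auxiliary parameter such as
`σ → 0` or a cluster order `m → ∞`, makes them sparse), nothing else.  Typed as the statement to be
checked by the disprover: [folklore] -/
def ConditioningCost : Prop :=
  ∀ {Ω : Type} [MeasurableSpace Ω] (G : Measure Ω) [IsProbabilityMeasure G] (A : Set Ω),
    MeasurableSet A → G A ≠ 0 → klDiv (ProbabilityTheory.cond G A) G = ENNReal.ofReal (-Real.log (G A).toReal)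

end Summit.AtomisticToContinuum.HydrodynamicLimit.Cruxes.HydroLimitProfilewiseBand.IdeatorOne

end
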